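import Summits.Ventures.AbcSig.Rows.Bridge
import Summits.Ventures.AbcSig.Rows.C2aL229A6
import Summits.Ventures.AbcSig.Rows.C2aL229A6AB

/-!
# Venture AbcSig — CELL `C2aL229A6`: the census statement `Rows.C2aCellRed 229 (fun a => 6 ≤ a) ∅` from the two row theorems

HONEST FRAMING. COMPUTATION cell `pub-abcsig`; CONDITIONAL theorem; no claim on ABC or any summit. Hypotheses exactly as
in `Rows/C2aL229A6.lean` and `Rows/C2aL229A6AB.lean`: `BS04Package` (CITED), `DataComplete …` (COMPUTED level files), and the
rows' per-orbit exclusions for BOTH family predicates (`famB`, `famAB`) as `∀ n a m, …` hypotheses (CITED: the census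
row's certificates). Conclusion = p1's census predicate (`Rows/Statements.lean`), all four coprime coefficient
distributions `A·B = 2^a·229^m`, reduced exponents `a < n`, `m < n` (RULING H1). GENERATED by plean/make_cell_bridges.py.
-/

namespace Summit.Ventures.AbcSig

/-- Cell `C2aL229A6`: `Rows.C2aCellRed 229 (fun a => 6 ≤ a) ∅` under the rows' hypotheses. -/
theorem cell_C2aL229A6 (M : NewformModel) (hP : M.BS04Package)
    (hD229 : M.DataComplete 229 level229Orbits)
    (hD458 : M.DataComplete 458 level458Orbits)
    (hX_orbit_229_3 : ∀ n a m : ℕ, n ∈ ([7, 19] : List ℕ) → M.Excludes 229 orbit_229_3 (famB (2 ^ a * 229 ^ m) n (fun _ _ => True)))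
    (hX_orbit_229_3' : ∀ n a m : ℕ, n ∈ ([7, 19] : List ℕ) → M.Excludes 229 orbit_229_3 (famAB (229 ^ m) (2 ^ a) n (fun _ _ => True)))
    (hX_orbit_458_5 : ∀ n a m : ℕ, n ∈ ([7, 23] : List ℕ) → M.Excludes 458 orbit_458_5 (famB (2 ^ a * 229 ^ m) n (fun _ _ => True)))
    (hX_orbit_458_5' : ∀ n a m : ℕ, n ∈ ([7, 23] : List ℕ) → M.Excludes 458 orbit_458_5 (famAB (229 ^ m) (2 ^ a) n (fun _ _ => True))) :
    Rows.C2aCellRed 229 (fun a => 6 ≤ a) ∅ :=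
  C2aCellRed_of_rows 229 (by norm_num) (by norm_num) _ _
    (fun n hn h11 hnℓ _ a m ha han hm hmn x y z h1 h2 =>
      row_C2aL229A6 M hP hD229 hD458 n hn h11 hnℓ a m ha hm han hmn (hX_orbit_229_3 n a m) (hX_orbit_458_5 n a m) x y z h1 h2)
    (fun n hn h11 hnℓ _ a m ha han hm hmn x y z h1 h2 =>
      row_C2aL229A6AB M hP hD229 hD458 n hn h11 hnℓ a m ha hm han hmn (hX_orbit_229_3' n a m) (hX_orbit_458_5' n a m) x y z h1 h2)

end Summit.Ventures.AbcSig
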